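import Summits.HodgeConjecture.HodgeConjecture.Theses.PeriodDeficiency
import Literature.AlgebraicGeometry.HodgeTheory.HodgeGenericQbarDescent
import Literature.AlgebraicGeometry.HodgeTheory.QbarGenericPointsDense
import Literature.AlgebraicGeometry.HodgeTheory.IsoTransport
import Literature.AlgebraicGeometry.HodgeTheory.SpreadingOutQbarFamilyProofs
import HarnessLib

/-!
# Route `LinearSystemTorelli` — crux `MiddleDivisorSupportFourfold` (stmt-HodgeConjecture-2409),
# line `IdeatorFiveSketch`, stub A: finite monodromy at the `ℚ̄`-generic spread point — reduction

Helper file for the crux item stmt-HodgeConjecture-2409 (`--supports`; it closes nothing), line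
`IdeatorFiveSketch` (idea `weakly-nonfactor-descent`), lead c3, stub A
`stub_finiteMonodromyAtGenericSpread` of the registered skeleton
`Cruxes/MiddleDivisorSupportFourfold/Lines/IdeatorFiveSketch.lean`:

  for `σ : ℚ̄ →+* ℂ` and a rational `(2,2)`-class `c` on a smooth projective complex fourfold `X`,
  there is a `ℚ̄`-spread `X ≅ 𝒳_s` (`f₀ : 𝒳₀ ⟶ S₀` a `ℚ̄`-morphism of quasi-projective `ℚ̄`-schemes,
  `S₀` smooth irreducible, `f₀ ⊗_σ ℂ` smooth projective of relative dimension `4`, `s` over the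
  generic point of `S₀`) on which the transported class `(e⁻¹)^* c` has FINITE monodromy orbit.

Stub A is the transcendence kernel of the line (Hodge-locus components through `ℚ̄`-generic points;
OPEN in general).  This file kernel-checks its REDUCTION to existing items and named facts, in the
shape of `PeriodDeficiencyGenericityReduction.lean` (`genericityReduction_of_three_facts`):

  `ClassicalGeometricVHS` (stmt-11597) → `QbarGenericIsHodgeGeneric` (stmt-11595) →
  `bku_finite_monodromyOrbit_of_isHodgeGenericIn` (named fact, Baldi–Klingler–Ullmo §3.2) → stub A,

the spread being supplied by the PROVED discharge `spreadingOut_smoothProjective_qbarFamily_holds`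
(`SpreadingOutQbarFamilyProofs.lean`) of the named fact `spreadingOut_smoothProjective_qbarFamily`,
and the `ℚ̄`-genericity principle "a `ℚ̄`-closed set of complex points through a point over the
generic point is everything" by the PROVED `IsDefinedOverQbar.eq_univ_of_closure_base_pt_eq_univ`
(`QbarGenericPointsDense.lean`, Lang III §5 C4 ⇒ C7 at the generic point).

Proof: spread `X` (so `s` lies over the generic point and `e : X ≅ 𝒳_s`); `ClassicalGeometricVHS`
gives the classical Betti–Hodge datum `B` and a geometric VHS datum `D` of `R⁴ f_* ℚ`;
`QbarGenericIsHodgeGeneric` makes `s` Hodge-generic in its `ℚ̄`-Zariski closure, which is all of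
`S(ℂ)`; the named fact at `p = 2` applied to `α := (e⁻¹)^* c` (rational by `IsRationalClass.map`, of
type `(2,2)` by `IsOfHodgeType.map_of_iso e.symm`) is the finiteness of the monodromy orbit.
-/

-- every declaration of this problem lives in `Summit.HodgeConjecture.HodgeConjecture.…`
set_option linter.dupNamespace false

noncomputable section

open CategoryTheory AlgebraicGeometry Topology
open Literature.AlgebraicGeometry Literature.AlgebraicGeometry.Motives
open Literature.AlgebraicGeometry.HodgeTheory
open Literature.AlgebraicTopology.SingularHomology

namespace Summit.HodgeConjecture.HodgeConjecture.Theorems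

/-- **Stub A from the two route items and the two named facts** (all four as hypotheses; the
shape of `genericityReduction_of_facts`).  For `σ : ℚ̄ →+* ℂ` and a rational `(2,2)`-class `c` on a
smooth projective complex fourfold `X`: spread `X` out over `ℚ̄` (`hSp`), `X ≅ 𝒳_s` with `s` over
the generic point of the smooth irreducible quasi-projective base `S₀`; the geometric VHS datum `D`
of `R⁴ (f₀ ⊗_σ ℂ)_* ℚ` for the classical Betti–Hodge datum (`hC`); `s` is Hodge-generic in its
`ℚ̄`-Zariski closure (`hG`), which is all of `S(ℂ)` because every `ℚ̄`-closed set through a point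
over the generic point is everything (`IsDefinedOverQbar.eq_univ_of_closure_base_pt_eq_univ`, the
quasi-projective `S₀` being locally of finite type); hence (`hB` at `p = 2`) the transported class
`(e⁻¹)^* c`, rational and of type `(2,2)`, has finite monodromy orbit.
[cite: CharlesSchnell2014Notes, Thm. 11.3.19 (proof)] [cite: Voisin2007HodgeLoci, §3, proof of Prop. 1.7]
[cite: BaldiKlinglerUllmo2024, §3.2] -/
theorem stub_finiteMonodromyAtGenericSpread_of_facts
    (hC : Summit.HodgeConjecture.HodgeConjecture.Theses.PeriodDeficiency.ClassicalGeometricVHS)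
    (hG : Summit.HodgeConjecture.HodgeConjecture.Theses.PeriodDeficiency.QbarGenericIsHodgeGeneric)
    (hSp : spreadingOut_smoothProjective_qbarFamily)
    (hB : bku_finite_monodromyOrbit_of_isHodgeGenericIn) :
    ∀ (σ : AlgebraicClosure ℚ →+* ℂ) ⦃X : SchemeOver ℂ⦄, IsSmoothProjective 4 X →
      ∀ (c : complexBetti X 4), IsRationalClass c → IsOfHodgeType 4 X 4 2 2 c →
        ∃ (𝒳₀ S₀ : SchemeOver (AlgebraicClosure ℚ)) (f₀ : 𝒳₀ ⟶ S₀)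
          (s : ComplexPoints ((baseChangeHom σ).obj S₀))
          (e : X ≅ fiberOver ((baseChangeHom σ).map f₀) s),
          IsQuasiProjectiveOver 𝒳₀ ∧ IsQuasiProjectiveOver S₀ ∧ IrreducibleSpace S₀.left ∧
          AlgebraicGeometry.Smooth S₀.hom ∧
          IsSmoothProjectiveFamily ((baseChangeHom σ).map f₀) 4 ∧
          closure {(baseChangeHomFst σ S₀).base s.pt} = (Set.univ : Set S₀.left) ∧
          {β : complexBetti (fiberOver ((baseChangeHom σ).map f₀) s) 4 |
              ∃ γ : Path s s, IsContinuationAlong γ (complexBetti.map e.inv 4 c) β}.Finite := by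
  intro σ X hX c hc hh
  -- spread `X` out over `ℚ̄`: `e : X ≅ 𝒳_s`, `s` over the generic point of `S₀`
  obtain ⟨𝒳₀, S₀, f₀, s, h𝒳₀, hS₀, hirr, hsm, hf, hgen, ⟨e⟩⟩ := hSp σ hX
  refine ⟨𝒳₀, S₀, f₀, s, e, h𝒳₀, hS₀, hirr, hsm, hf, hgen, ?_⟩
  -- the classical Betti–Hodge datum and the geometric VHS datum of `R⁴ f_* ℚ`
  obtain ⟨B, hBc, hT, hD⟩ := hC
  haveI : HodgeTensorFacts.{0, 0} := hT
  obtain ⟨D, hfin⟩ := hD σ f₀ 4 (2 * 2) hf hirr hsm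
  haveI : ∀ t, Module.Finite ℚ (D.V.fiber t) := hfin
  -- `s` is Hodge-generic in its `ℚ̄`-Zariski closure, which is everything
  have hHG := hG B hBc σ f₀ 4 (2 * 2) D hirr hsm s
  have hW : (⋂₀ {Z | IsDefinedOverQbar σ S₀ Z ∧ s ∈ Z}) =
      (Set.univ : Set (ComplexPoints ((baseChangeHom σ).obj S₀))) := by
    rw [Set.sInter_eq_univ]
    rintro Z ⟨hZ, hsZ⟩
    haveI : LocallyOfFiniteType S₀.hom := locallyOfFiniteType_of_isQuasiProjectiveOver hS₀
    exact hZ.eq_univ_of_closure_base_pt_eq_univ hsZ hgen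
  rw [hW] at hHG
  -- finite monodromy orbit of the transported class `(e⁻¹)^* c` (rational, of type `(2,2)`)
  exact hB B hBc σ f₀ 4 2 D h𝒳₀ hS₀ hirr hsm s hHG (complexBetti.map e.inv 4 c) (hc.map _)
    (hh.map_of_iso e.symm)

/-- **Stub A ⟸ `ClassicalGeometricVHS` ∧ `QbarGenericIsHodgeGeneric` modulo the single named fact
`bku_finite_monodromyOrbit_of_isHodgeGenericIn`** (registered sub-goal of stmt-HodgeConjecture-2409; the
three antecedents come first, then VERBATIM the registered stub A).  The spreading-out input of
`stub_finiteMonodromyAtGenericSpread_of_facts` is the PROVED discharge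
`spreadingOut_smoothProjective_qbarFamily_holds` (descent of `X ↪ ℙᴺ_ℂ` to a finitely generated
`ℚ̄(t₀)`, projective model over `ℚ̄[t₀]`, spreading of smoothness, Stacks Tag 0AY8); what remains
as hypotheses are the two items of route `PeriodDeficiency` — `ClassicalGeometricVHS` (stmt-11597,
infrastructure) and the open crux `QbarGenericIsHodgeGeneric` (stmt-11595, "a `ℚ̄`-generic point is
Hodge-generic", KOU Conj. 1.5(a) pointwise) — and the named fact "Hodge classes at a Hodge-generic
point have finite monodromy orbit" (Baldi–Klingler–Ullmo §3.2; no `_holds` in the tree, only the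
reductions `bku_finite_monodromyOrbit_of_isHodgeGenericIn_of_hType` / `_of_generic_complex` to
Deligne's existence of tensor-generic points).  The conclusion is VERBATIM the registered stub
`stub_finiteMonodromyAtGenericSpread` of line `IdeatorFiveSketch`.
[cite: CharlesSchnell2014Notes, Thm. 11.3.19 (proof)] [cite: Voisin2007HodgeLoci, §3, proof of Prop. 1.7]
[cite: BaldiKlinglerUllmo2024, §3.2] -/
theorem stub_finiteMonodromyAtGenericSpread_of_qbarGenericIsHodgeGeneric :
    Summit.HodgeConjecture.HodgeConjecture.Theses.PeriodDeficiency.ClassicalGeometricVHS →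
    Summit.HodgeConjecture.HodgeConjecture.Theses.PeriodDeficiency.QbarGenericIsHodgeGeneric →
    Literature.AlgebraicGeometry.HodgeTheory.bku_finite_monodromyOrbit_of_isHodgeGenericIn →
    ∀ (σ : AlgebraicClosure ℚ →+* ℂ) ⦃X : SchemeOver ℂ⦄, IsSmoothProjective 4 X →
      ∀ (c : complexBetti X 4), IsRationalClass c → IsOfHodgeType 4 X 4 2 2 c →
        ∃ (𝒳₀ S₀ : SchemeOver (AlgebraicClosure ℚ)) (f₀ : 𝒳₀ ⟶ S₀)
          (s : ComplexPoints ((baseChangeHom σ).obj S₀))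
          (e : X ≅ fiberOver ((baseChangeHom σ).map f₀) s),
          IsQuasiProjectiveOver 𝒳₀ ∧ IsQuasiProjectiveOver S₀ ∧ IrreducibleSpace S₀.left ∧
          AlgebraicGeometry.Smooth S₀.hom ∧
          IsSmoothProjectiveFamily ((baseChangeHom σ).map f₀) 4 ∧
          closure {(baseChangeHomFst σ S₀).base s.pt} = (Set.univ : Set S₀.left) ∧
          {β : complexBetti (fiberOver ((baseChangeHom σ).map f₀) s) 4 |
              ∃ γ : Path s s, IsContinuationAlong γ (complexBetti.map e.inv 4 c) β}.Finite :=
  fun hC hG hB ↦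
    stub_finiteMonodromyAtGenericSpread_of_facts hC hG spreadingOut_smoothProjective_qbarFamily_holds hB

end Summit.HodgeConjecture.HodgeConjecture.Theorems

end
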